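import Summits.KontsevichZagierPeriods.Zeta5Search.WedgeDictionaryTopRelation
import Summits.KontsevichZagierPeriods.Zeta5Search.WedgeDictionaryFaceAbel
import Summits.KontsevichZagierPeriods.Zeta5Search.WedgeDictionaryFaceSymmetric
import HarnessLib

/-!
# REC3: the third-order recurrence of the Casoratian `M₃` along the slot `b₇` (cell `pub-zeta5`)

HONEST FRAMING: systematic search; no irrationality claim unless certified.

OUR work (Summit side; lead/literature seat generation 4, 2026-08-20). Step L5 of the cell's Lean plan for the
INTERIOR of CF-M3 (`casoratianClosedForm`; paper-level proof by gen-1 g5, `HOME/pub-zeta5-gen-1/PROOF-NOTES-g5.md`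
§4, §10.2): from gen-1 g5's four-term relation `top_fourTerm` (`WedgeDictionaryTopRelation`, filed by typer g6) and
the linear-functional summability principle (`coeff_rel_of_summable_sum`, `WedgeDictionaryFaceSymmetric`):

* `fourTerm_coeff_rel`: `γ₃Λ(b+3e₇) + γ₂Λ(b+2e₇) + γ₁Λ(b+e₇) + γ₀Λ(b) = 0` for `Λ = U` and `Λ = W`
  (`γ_k = topGamma_k b`; hypotheses `d(b) ≥ 2`, `b₇ + 2 ≤ N`).
* `casoratian_pair_identities` (2×2 determinant algebra): with `X(a) = M₃(a) = U(a)W(a+e₇) − U(a+e₇)W(a)`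
  (`wedgeQ_eq_quadM3`) and `D(a) = U(a)W(a+2e₇) − U(a+2e₇)W(a)`:
  `γ₃·D(b+e₇) + γ₂·M₃(b+e₇) − γ₀·M₃(b) = 0` and `γ₃·M₃(b+2e₇) = γ₀·D(b) + γ₁·M₃(b+e₇)`.
* `quadM3_rec3` (REC3 of the notes, `m = a₇ + 2`):
  `γ₃(a')γ₃(a)·M₃(a+3e₇) = γ₁(a')γ₃(a)·M₃(a+2e₇) − γ₀(a')γ₂(a)·M₃(a+e₇) + γ₀(a')γ₀(a)·M₃(a)`, `a' = a+e₇`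
  (hypotheses `d(a) ≥ 3`, `a₇ + 3 ≤ N`).
* Initial data from the face: the THREE-term relation in the direction of slot 7 AT THE FACE `b₇ = 0`
  (`face_threeTerm_seven`; its coefficients are the monomial-basis `q₂ = d(b)`, `q₁ = 4N³−3e₁N²+2e₂N−e₃`,
  `q₀ = N⁵−e₁N⁴+e₂N³−e₃N²+e₄N−e₅` of the face quadratic — NOT `faceGamma0 b 6`, whose product form needs the
  moving slot to be one of `b₁..b₆`), hence `face_initial`: `d(b)·M₃(b+e₇) = q₀·M₃(b)` and `d(b)·D(b) = −(q₁−(N−1)d)·M₃(b)`.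

Remaining for the interior (P1 / typer per HOME/STATUS routing): L8 (the recurrence of `Ω` in slot 7 from
`WedgeDictionaryTelescope`) and L9 (induction along slot 7 from `casoratianClosedForm_face`).
-/

noncomputable section

open Finset Polynomial

namespace Summit.KontsevichZagierPeriods.Zeta5Search.WedgeDictionary

open Summit.KontsevichZagierPeriods.Zeta5Search.DualSeries
open Literature.NumberTheory.Transcendental
open Literature.NumberTheory.Transcendental.BallRivoal (pochPoly eval_pochPoly)

/-! ### The shapes `b + k·e₇` -/

/-- `(b + e₇)₇ = b₇ + 1`. -/
theorem bump6_seven (b : ℕ → ℤ) : bump b 6 7 = b 7 + 1 := bump_self b 6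

/-- In the box along slot 7. -/
theorem inBox_bump6 (b : ℕ → ℤ) (hb : InBox b) (h : b 7 ≤ b 0) : InBox (bump b 6) :=
  inBox_update b hb (i := 6) (mem_range.2 (by norm_num)) h

/-- `Σ_j b_j = 3N − d(b)` (the slot sum through `d`). -/
theorem sum_slots_eq (b : ℕ → ℤ) : ∑ j ∈ range 7, b (j + 1) = 3 * b 0 - dOf b := by
  unfold dOf; ring

/-- `deg((X+N)(X−1)·h_b) + 1 ≤ 6N` as soon as `d(b) ≥ 2`. -/
theorem natDegree_topTelescoper_succ_le (b : ℕ → ℤ) (hb : InBox b) (hd : 2 ≤ dOf b) :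
    (topTelescoper b).natDegree + 1 ≤ 6 * (b 0).toNat := by
  have h1 := natDegree_hPoly_le b
  have h2 : ((X + C (b 0 : ℚ)) * (X - C 1)).natDegree ≤ 2 := by
    refine natDegree_mul_le.trans ?_
    rw [natDegree_X_add_C, natDegree_X_sub_C]
  have h3 : (topTelescoper b).natDegree ≤ 2 + ∑ j ∈ range 7, 2 * (b (j + 1)).toNat := by
    unfold topTelescoper
    exact natDegree_mul_le.trans (add_le_add h2 h1)
  obtain ⟨h0, hj⟩ := hb
  have hb0 : (b 0 : ℤ) = ((b 0).toNat : ℤ) := (Int.toNat_of_nonneg h0).symm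
  have hS : ∑ j ∈ range 7, b (j + 1) = ((∑ j ∈ range 7, (b (j + 1)).toNat : ℕ) : ℤ) := by
    rw [Nat.cast_sum]
    exact sum_congr rfl fun j hj' => (Int.toNat_of_nonneg (hj j hj').1).symm
  have h4 : ∑ j ∈ range 7, 2 * (b (j + 1)).toNat = 2 * ∑ j ∈ range 7, (b (j + 1)).toNat := by rw [mul_sum]
  unfold dOf at hd
  rw [hS, hb0] at hd
  omega

/-! ### L5(a): the four-term coefficient relation along slot 7 -/

/-- **The four-term coefficient relation.** For `b` in the box with `d(b) ≥ 2` and `b₇ + 2 ≤ N`: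
`γ₃·Λ(b+3e₇) + γ₂·Λ(b+2e₇) + γ₁·Λ(b+e₇) + γ₀·Λ(b) = 0` for `Λ = U, W` (`γ_k = topGamma_k b`). -/
theorem fourTerm_coeff_rel (b : ℕ → ℤ) (hb : InBox b) (hd : 2 ≤ dOf b) (h7 : b 7 + 2 ≤ b 0) :
    (topGamma3 b * coeffU (bump (bump (bump b 6) 6) 6) + topGamma2 b * coeffU (bump (bump b 6) 6) +
        topGamma1 b * coeffU (bump b 6) + topGamma0 b * coeffU b = 0) ∧
      (topGamma3 b * coeffW (bump (bump (bump b 6) 6) 6) + topGamma2 b * coeffW (bump (bump b 6) 6) +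
        topGamma1 b * coeffW (bump b 6) + topGamma0 b * coeffW b = 0) := by
  have hi7 : (6 : ℕ) ∈ range 7 := mem_range.2 (by norm_num)
  set b1 := bump b 6 with hb1def
  set b2 := bump b1 6 with hb2def
  set b3 := bump b2 6 with hb3def
  have e10 : b1 0 = b 0 := bump_zero b 6
  have e20 : b2 0 = b 0 := (bump_zero b1 6).trans e10
  have e30 : b3 0 = b 0 := (bump_zero b2 6).trans e20
  have e17 : b1 7 = b 7 + 1 := bump6_seven b
  have e27 : b2 7 = b 7 + 2 := by rw [hb2def, bump6_seven, e17]; ring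
  have hd1 : dOf b1 = dOf b - 1 := dOf_bump b hi7
  have hd2 : dOf b2 = dOf b - 2 := by rw [hb2def, dOf_bump b1 hi7, hd1]; ring
  have hd3 : dOf b3 = dOf b - 3 := by rw [hb3def, dOf_bump b2 hi7, hd2]; ring
  have hB1 : InBox b1 := inBox_bump6 b hb (by omega)
  have hB2 : InBox b2 := inBox_bump6 b1 hB1 (by rw [e17, e10]; omega)
  have hB3 : InBox b3 := inBox_bump6 b2 hB2 (by rw [e27, e20]; omega)
  have hNz : ((b 0).toNat : ℤ) = b 0 := Int.toNat_of_nonneg hb.1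
  have hN : 1 ≤ (b 0).toNat := by have h70 : 0 ≤ b 7 := (hb.2 6 hi7).1; omega
  have key := coeff_rel_of_summable_sum (Finset.univ : Finset (Fin 4)) ![b, b1, b2, b3]
    ![topGamma0 b, topGamma1 b, topGamma2 b, topGamma3 b] (b 0).toNat hN
    (by
      intro i _
      fin_cases i
      · exact hb
      · exact hB1
      · exact hB2
      · exact hB3)
    (by
      intro i _
      fin_cases i
      · show ∑ j ∈ range 7, b (j + 1) ≤ 3 * b 0 + 1
        rw [sum_slots_eq]; omega
      · show ∑ j ∈ range 7, b1 (j + 1) ≤ 3 * b1 0 + 1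
        rw [sum_slots_eq, hd1]; omega
      · show ∑ j ∈ range 7, b2 (j + 1) ≤ 3 * b2 0 + 1
        rw [sum_slots_eq, hd2]; omega
      · show ∑ j ∈ range 7, b3 (j + 1) ≤ 3 * b3 0 + 1
        rw [sum_slots_eq, hd3]; omega)
    (by
      intro i _
      fin_cases i
      · rfl
      · show (b1 0).toNat = (b 0).toNat
        rw [e10]
      · show (b2 0).toNat = (b 0).toNat
        rw [e20]
      · show (b3 0).toNat = (b 0).toNat
        rw [e30])
    (topTelescoper b) (natDegree_topTelescoper_succ_le b hb hd)
    (by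
      rw [Fin.sum_univ_four]
      show C (topGamma0 b) * numPoly b + C (topGamma1 b) * numPoly b1 + C (topGamma2 b) * numPoly b2 +
          C (topGamma3 b) * numPoly b3 = _
      rw [← top_fourTerm b hb]
      ring)
  rw [Fin.sum_univ_four, Fin.sum_univ_four] at key
  obtain ⟨kU, kW⟩ := key
  change topGamma0 b * coeffU b + topGamma1 b * coeffU b1 + topGamma2 b * coeffU b2 + topGamma3 b * coeffU b3 = 0 at kU
  change topGamma0 b * coeffW b + topGamma1 b * coeffW b1 + topGamma2 b * coeffW b2 + topGamma3 b * coeffW b3 = 0 at kW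
  constructor
  · linear_combination kU
  · linear_combination kW

/-! ### L5(b): Casoratian propagation (2×2 determinant algebra) -/

/-- **The two determinant identities.** With `D(a) = U(a)W(a+2e₇) − U(a+2e₇)W(a)`:
`γ₃·D(b+e₇) + γ₂·M₃(b+e₇) − γ₀·M₃(b) = 0` and `γ₃·M₃(b+2e₇) = γ₀·D(b) + γ₁·M₃(b+e₇)` (`γ_k = topGamma_k b`). -/
theorem casoratian_pair_identities (b : ℕ → ℤ) (hb : InBox b) (hd : 2 ≤ dOf b) (h7 : b 7 + 2 ≤ b 0) :
    (topGamma3 b * (coeffU (bump b 6) * coeffW (bump (bump (bump b 6) 6) 6) -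
          coeffU (bump (bump (bump b 6) 6) 6) * coeffW (bump b 6)) +
        topGamma2 b * quadM3 (bump b 6) - topGamma0 b * quadM3 b = 0) ∧
      (topGamma3 b * quadM3 (bump (bump b 6) 6) =
        topGamma0 b * (coeffU b * coeffW (bump (bump b 6) 6) - coeffU (bump (bump b 6) 6) * coeffW b) +
          topGamma1 b * quadM3 (bump b 6)) := by
  have hi7 : (6 : ℕ) ∈ range 7 := mem_range.2 (by norm_num)
  obtain ⟨hU, hW⟩ := fourTerm_coeff_rel b hb hd h7
  have e10 : bump b 6 0 = b 0 := bump_zero b 6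
  have e17 : bump b 6 7 = b 7 + 1 := bump6_seven b
  have e20 : bump (bump b 6) 6 0 = b 0 := (bump_zero _ 6).trans e10
  have e27 : bump (bump b 6) 6 7 = b 7 + 2 := by rw [bump6_seven, e17]; ring
  have hd1 : dOf (bump b 6) = dOf b - 1 := dOf_bump b hi7
  have hd2 : dOf (bump (bump b 6) 6) = dOf b - 2 := by rw [dOf_bump _ hi7, hd1]; ring
  have hB1 : InBox (bump b 6) := inBox_bump6 b hb (by omega)
  have hB2 : InBox (bump (bump b 6) 6) := inBox_bump6 _ hB1 (by rw [e17, e10]; omega)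
  -- the three Casoratians are `quadM3`
  have q0 : coeffU b * coeffW (bump b 6) - coeffU (bump b 6) * coeffW b = quadM3 b :=
    wedgeQ_eq_quadM3 b hb (by omega) hi7 (show b 7 ≤ b 0 by omega)
  have q1 : coeffU (bump b 6) * coeffW (bump (bump b 6) 6) - coeffU (bump (bump b 6) 6) * coeffW (bump b 6) =
      quadM3 (bump b 6) :=
    wedgeQ_eq_quadM3 (bump b 6) hB1 (by rw [hd1]; omega) hi7 (show bump b 6 7 ≤ bump b 6 0 by rw [e17, e10]; omega)
  have q2 : coeffU (bump (bump b 6) 6) * coeffW (bump (bump (bump b 6) 6) 6) -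
      coeffU (bump (bump (bump b 6) 6) 6) * coeffW (bump (bump b 6) 6) = quadM3 (bump (bump b 6) 6) :=
    wedgeQ_eq_quadM3 (bump (bump b 6) 6) hB2 (by rw [hd2]; omega) hi7
      (show bump (bump b 6) 6 7 ≤ bump (bump b 6) 6 0 by rw [e27, e20]; omega)
  constructor
  · linear_combination coeffU (bump b 6) * hW - coeffW (bump b 6) * hU - topGamma2 b * q1 + topGamma0 b * q0
  · linear_combination (-coeffW (bump (bump b 6) 6)) * hU + coeffU (bump (bump b 6) 6) * hW -
      topGamma3 b * q2 + topGamma1 b * q1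

/-- **REC3** (PROOF-NOTES-g5 §4.2, with `m = a₇ + 2`): for `a` in the box with `d(a) ≥ 3`, `a₇ + 3 ≤ N`, and
`a' = a + e₇`:
`γ₃(a')γ₃(a)·M₃(a+3e₇) = γ₁(a')γ₃(a)·M₃(a+2e₇) − γ₀(a')γ₂(a)·M₃(a+e₇) + γ₀(a')γ₀(a)·M₃(a)`. -/
theorem quadM3_rec3 (a : ℕ → ℤ) (ha : InBox a) (hd : 3 ≤ dOf a) (h7 : a 7 + 3 ≤ a 0) :
    topGamma3 (bump a 6) * topGamma3 a * quadM3 (bump (bump (bump a 6) 6) 6) =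
      topGamma1 (bump a 6) * topGamma3 a * quadM3 (bump (bump a 6) 6) -
        topGamma0 (bump a 6) * topGamma2 a * quadM3 (bump a 6) + topGamma0 (bump a 6) * topGamma0 a * quadM3 a := by
  have hi7 : (6 : ℕ) ∈ range 7 := mem_range.2 (by norm_num)
  have e10 : bump a 6 0 = a 0 := bump_zero a 6
  have e17 : bump a 6 7 = a 7 + 1 := bump6_seven a
  have hd1 : dOf (bump a 6) = dOf a - 1 := dOf_bump a hi7
  have hA1 : InBox (bump a 6) := inBox_bump6 a ha (by omega)
  obtain ⟨hA, _⟩ := casoratian_pair_identities a ha (by omega) (by omega)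
  obtain ⟨_, hB⟩ := casoratian_pair_identities (bump a 6) hA1 (by rw [hd1]; omega) (by rw [e17, e10]; omega)
  linear_combination topGamma3 a * hB + topGamma0 (bump a 6) * hA

/-! ### L5(c): the three-term relation in the direction of slot 7 at the face, and the initial data -/

/-- The scalar identity behind the slot-7 relation at the face:
`(2x+N)·(d·y² + q₁·y + q₀) = ∏_{k≤6}(x+N−b_k) − ∏_{k≤6}(x+b_k)`, `y = x(x+N)`, with
`q₁ = 4N³−3e₁N²+2e₂N−e₃`, `q₀ = N⁵−e₁N⁴+e₂N³−e₃N²+e₄N−e₅` (one `ring`). -/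
theorem face_scalar_identity_seven (b : ℕ → ℤ) (h7 : b 7 = 0) (x : ℚ) :
    (2 * x + (b 0 : ℚ)) *
        ((dOf b : ℚ) * (x * (x + (b 0 : ℚ))) ^ 2 +
          (4 * (b 0 : ℚ) ^ 3 - 3 * fe1 b * (b 0 : ℚ) ^ 2 + 2 * fe2 b * (b 0 : ℚ) - fe3 b) * (x * (x + (b 0 : ℚ))) +
          ((b 0 : ℚ) ^ 5 - fe1 b * (b 0 : ℚ) ^ 4 + fe2 b * (b 0 : ℚ) ^ 3 - fe3 b * (b 0 : ℚ) ^ 2 +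
            fe4 b * (b 0 : ℚ) - fe5 b)) =
      (∏ k ∈ range 6, (x + ((b 0 : ℚ) - b (k + 1)))) - ∏ k ∈ range 6, (x + (b (k + 1) : ℚ)) := by
  have hd : (dOf b : ℚ) = 3 * (b 0 : ℚ) - ((b 1 : ℚ) + (b 2 : ℚ) + (b 3 : ℚ) + (b 4 : ℚ) + (b 5 : ℚ) + (b 6 : ℚ)) := by
    unfold dOf
    simp only [sum_range_succ, sum_range_zero, h7]
    push_cast
    ring
  simp only [fe1, fe2, fe3, fe4, fe5, prod_range_succ, prod_range_zero, hd]
  ring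

/-- **The three-term relation in the direction of slot 7 at the face `b₇ = 0`** (relation (3T) of
PROOF-NOTES-g5 §4): `d(b)·numPoly(b+2e₇) + (q₁ − (N−1)d(b))·numPoly(b+e₇) + q₀·numPoly(b) = g(X+1)X⁶ − g(X+N)⁶`,
`g = −h_b`. -/
theorem face_threeTerm_seven (b : ℕ → ℤ) (hb : InBox b) (h7 : b 7 = 0) :
    C (dOf b : ℚ) * numPoly (bump (bump b 6) 6) +
        C ((4 * (b 0 : ℚ) ^ 3 - 3 * fe1 b * (b 0 : ℚ) ^ 2 + 2 * fe2 b * (b 0 : ℚ) - fe3 b) -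
            ((b 0 : ℚ) - 1) * (dOf b : ℚ)) * numPoly (bump b 6) +
        C ((b 0 : ℚ) ^ 5 - fe1 b * (b 0 : ℚ) ^ 4 + fe2 b * (b 0 : ℚ) ^ 3 - fe3 b * (b 0 : ℚ) ^ 2 +
            fe4 b * (b 0 : ℚ) - fe5 b) * numPoly b =
      (-hPoly b).comp (X + C 1) * X ^ 6 - (-hPoly b) * (X + C (((b 0).toNat : ℕ) : ℚ)) ^ 6 := by
  have hi7 : (6 : ℕ) ∈ range 7 := mem_range.2 (by norm_num)
  have h67 : b (6 + 1) = 0 := h7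
  have hN : (((b 0).toNat : ℕ) : ℚ) = (b 0 : ℚ) := by exact_mod_cast Int.toNat_of_nonneg hb.1
  have e1 : numPoly (bump b 6) = numPoly b * ((X + C (b (6 + 1) : ℚ)) * (X + C ((b 0 - b (6 + 1) : ℤ) : ℚ))) :=
    numPoly_update b hi7 (by rw [h67])
  have e2 : numPoly (bump (bump b 6) 6) =
      numPoly (bump b 6) * ((X + C (bump b 6 (6 + 1) : ℚ)) * (X + C ((bump b 6 0 - bump b 6 (6 + 1) : ℤ) : ℚ))) :=
    numPoly_update (bump b 6) hi7 (by rw [bump_self]; omega)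
  rw [bump_self, bump_zero, h67] at e2
  rw [h67] at e1
  suffices hmain : (X + C (b 0 : ℚ)) * X *
      (C (dOf b : ℚ) * numPoly (bump (bump b 6) 6) +
          C ((4 * (b 0 : ℚ) ^ 3 - 3 * fe1 b * (b 0 : ℚ) ^ 2 + 2 * fe2 b * (b 0 : ℚ) - fe3 b) -
              ((b 0 : ℚ) - 1) * (dOf b : ℚ)) * numPoly (bump b 6) +
          C ((b 0 : ℚ) ^ 5 - fe1 b * (b 0 : ℚ) ^ 4 + fe2 b * (b 0 : ℚ) ^ 3 - fe3 b * (b 0 : ℚ) ^ 2 +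
              fe4 b * (b 0 : ℚ) - fe5 b) * numPoly b -
        ((-hPoly b).comp (X + C 1) * X ^ 6 - (-hPoly b) * (X + C (((b 0).toNat : ℕ) : ℚ)) ^ 6)) = 0 by
    have hne : (X + C (b 0 : ℚ)) * X ≠ 0 := mul_ne_zero (X_add_C_ne_zero _) X_ne_zero
    exact sub_eq_zero.1 ((mul_eq_zero.1 hmain).resolve_left hne)
  apply Polynomial.funext
  intro x
  have hHA := hPoly_eval_mul b hb h7 x
  have hH1A := hPoly_eval_succ_mul b hb h7 x
  have estar := face_scalar_identity_seven b h7 x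
  rw [e2, e1]
  simp only [eval_mul, eval_add, eval_sub, eval_neg, eval_comp, eval_pow, eval_C, eval_X, eval_zero,
    eval_numPoly, eval_hPoly, hN]
  push_cast at hHA hH1A ⊢
  linear_combination ((∏ j ∈ range 7, (BallRivoal.poch x (b (j + 1)).toNat *
      BallRivoal.poch (x + ((b 0 : ℚ) - (b (j + 1) : ℚ) + 1)) (b (j + 1)).toNat)) * x * (x + (b 0 : ℚ))) * estar +
    (x + (b 0 : ℚ)) * hH1A - x * hHA

/-- **Initial data of REC3 from the face** (`X₁ = (q₀/q₂)X₀`, `D₀` of PROOF-NOTES-g5 §4.2, cleared of the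
division): for `b` in the box with `b₇ = 0` and `d(b) ≥ 1`,
`d(b)·M₃(b+e₇) = q₀·M₃(b)` and `d(b)·D(b) = −(q₁ − (N−1)d(b))·M₃(b)`, `D(b) = U(b)W(b+2e₇) − U(b+2e₇)W(b)`. -/
theorem face_initial (b : ℕ → ℤ) (hb : InBox b) (h7 : b 7 = 0) (hd : 1 ≤ dOf b) :
    ((dOf b : ℚ) * quadM3 (bump b 6) =
        ((b 0 : ℚ) ^ 5 - fe1 b * (b 0 : ℚ) ^ 4 + fe2 b * (b 0 : ℚ) ^ 3 - fe3 b * (b 0 : ℚ) ^ 2 +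
          fe4 b * (b 0 : ℚ) - fe5 b) * quadM3 b) ∧
      ((dOf b : ℚ) * (coeffU b * coeffW (bump (bump b 6) 6) - coeffU (bump (bump b 6) 6) * coeffW b) =
        -((4 * (b 0 : ℚ) ^ 3 - 3 * fe1 b * (b 0 : ℚ) ^ 2 + 2 * fe2 b * (b 0 : ℚ) - fe3 b) -
            ((b 0 : ℚ) - 1) * (dOf b : ℚ)) * quadM3 b) := by
  have hi7 : (6 : ℕ) ∈ range 7 := mem_range.2 (by norm_num)
  have hNz : ((b 0).toNat : ℤ) = b 0 := Int.toNat_of_nonneg hb.1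
  have h70 : b 7 ≤ b 0 := by rw [h7]; exact hb.1
  have e10 : bump b 6 0 = b 0 := bump_zero b 6
  have e17 : bump b 6 7 = b 7 + 1 := bump6_seven b
  have e20 : bump (bump b 6) 6 0 = b 0 := (bump_zero _ 6).trans e10
  have hd1 : dOf (bump b 6) = dOf b - 1 := dOf_bump b hi7
  have hd2 : dOf (bump (bump b 6) 6) = dOf b - 2 := by rw [dOf_bump _ hi7, hd1]; ring
  have hN : 1 ≤ (b 0).toNat := by
    have : dOf b ≤ 3 * b 0 := by
      rw [← sub_nonneg, show 3 * b 0 - dOf b = ∑ j ∈ range 7, b (j + 1) by rw [sum_slots_eq]]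
      exact sum_nonneg fun j hj => (hb.2 j hj).1
    omega
  have hB1 : InBox (bump b 6) := inBox_bump6 b hb h70
  have hB2 : InBox (bump (bump b 6) 6) := inBox_bump6 _ hB1 (by rw [e17, e10, h7]; omega)
  obtain ⟨hU, hW⟩ := coeff_rel_of_summable (bump (bump b 6) 6) (bump b 6) b (b 0).toNat hN hB2 hB1 hb
    (by rw [sum_slots_eq, hd2]; omega) (by rw [sum_slots_eq, hd1]; omega) (by rw [sum_slots_eq]; omega)
    (by rw [e20]) (by rw [e10]) rfl _ _ _ (-hPoly b) (natDegree_neg_hPoly_succ_le b hb hd)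
    (face_threeTerm_seven b hb h7)
  have q0 : coeffU b * coeffW (bump b 6) - coeffU (bump b 6) * coeffW b = quadM3 b :=
    wedgeQ_eq_quadM3 b hb (by omega) hi7 h70
  have q1 : coeffU (bump b 6) * coeffW (bump (bump b 6) 6) - coeffU (bump (bump b 6) 6) * coeffW (bump b 6) =
      quadM3 (bump b 6) :=
    wedgeQ_eq_quadM3 (bump b 6) hB1 (by rw [hd1]; omega) hi7 (show bump b 6 7 ≤ bump b 6 0 by rw [e17, e10, h7]; omega)
  constructor
  · linear_combination (-coeffW (bump b 6)) * hU + coeffU (bump b 6) * hW -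
      (dOf b : ℚ) * q1 + ((b 0 : ℚ) ^ 5 - fe1 b * (b 0 : ℚ) ^ 4 + fe2 b * (b 0 : ℚ) ^ 3 - fe3 b * (b 0 : ℚ) ^ 2 +
          fe4 b * (b 0 : ℚ) - fe5 b) * q0
  · linear_combination coeffU b * hW - coeffW b * hU -
      ((4 * (b 0 : ℚ) ^ 3 - 3 * fe1 b * (b 0 : ℚ) ^ 2 + 2 * fe2 b * (b 0 : ℚ) - fe3 b) -
          ((b 0 : ℚ) - 1) * (dOf b : ℚ)) * q0

end Summit.KontsevichZagierPeriods.Zeta5Search.WedgeDictionary
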